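import Mathlib
import Literature.MathematicalPhysics.StatisticalMechanics.BarlowStackingEnergy
import Literature.MathematicalPhysics.StatisticalMechanics.HaggStacking
import Literature.MathematicalPhysics.StatisticalMechanics.LennardJonesClusters
import Literature.MathematicalPhysics.StatisticalMechanics.BarlowStackingWindowRebase
import Summits.AtomisticToContinuum.Crystallization.Theorems.SquareWellLayerCakeStackingFaultSparsityDefs

/-!
# Assembly of `DiluteFaults` (stub `stub_diluteAssembly` of `StackingFaultSparsity`, line `Sketch`)

Support of item `stmt-AtomisticToContinuum-14296` (`StackingFaultSparsity`, routes
`SquareWellLayerCake` / `LaminarSixThreeThree`), line `Sketch`, survey tag M3f: the real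
bookkeeping that assembles the four numerics-free pieces of the restacking competitor
(injectivity of the block-shift competitor, the exact-lattice ledger, the perturbative transfer,
the Hägg-chain block-flip facts) and the uniform gain on the box into `DiluteFaults`: for
`L ≥ L₀` and a suitable `ε₁ = ε₁(L) > 0`, an `(L, ε₁)`-window of a Lennard-Jones ground state
two-way matched to a box Barlow stacking carries at most `M₀` cubic Hägg letters.

Proof.  If a window carried `> M₀` cubic letters, four of them are close
(`exists_four_close_of_card_lt`, span `≤ 6M/(M₀-2)`, `M = ⌊L/(2h)⌋₊`); the ℤ/3 pigeonhole (chain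
fact (a)) gives a zero-charge block `[q₁, q₂)` with cubic ends.  The match is RE-BASED at the
point `barlowPos a h s q₁ i₁ j₁` of layer `q₁` laterally nearest to the old base
(`exists_barlowPos_dist_le_of_layer`, `twoWayMatch_rebase`: radius `R'`, tolerance `2ε₁`), so
that the cylinder base IS the window base.  With `ρ = L/8`, `K = ⌈√L⌉₊`,
`R = ρ + (q₂-q₁)h + Kh + 1`, `R' = R + 1`: the ledger, chain fact (d) and the gain give
`Δ(P) ≤ -κ c_col ρ² + C_rim ρ (m+2K) + C_T ρ² (m+2K) K⁻³`, the transfer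
`Δ(x) ≤ Δ(P) + 2 C_p ε₁ ρ² m + C_T' ρ² m K⁻³`, injectivity and the ground state `0 ≤ Δ(x)`;
for `M₀ - 2 ≥ 192 (C_rim + C_T + C_T' + 1)/(h_min κ c_col)`, `L ≥ L₀` and
`ε₁ ≤ κ c_col h_min (M₀-2)/(48 (C_p+1) L)` the error terms sum to `< κ c_col ρ²`
(`assembly_core`), a contradiction.  No numerics, no new constants.
-/

noncomputable section
namespace Summit.AtomisticToContinuum.Crystallization.Theorems.SquareWellLayerCake.StackingFaultSparsity
open Literature.MathematicalPhysics.StatisticalMechanics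
/-- Euclidean `3`-space. [folklore] -/
local notation "E3" => EuclideanSpace ℝ (Fin 3)

/-! ## Real bookkeeping -/

/-- **The real bookkeeping of the assembly.**  With `L = 8ρ`, `t = √L`, `t ≤ k ≤ t + 1`
(`k = K`), `W = h_min (M₀ - 2)`, `192 (C_rim + C_T + C_T' + 1) ≤ P₀ W`, `256 (C_rim + 1) ≤ P₀ t`,
`128 (C_T + 1) ≤ P₀ L`, block length `m` with `m W ≤ 3L` and tolerance `ε` with
`48 (C_p + 1) ε L ≤ 2 P₀ W`, the rim, tail and transfer error terms sum to less than the bulk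
gain `P₀ ρ²` (each is at most `P₀ ρ²/8`). -/
private theorem assembly_core {P₀ W SC C_rim C_T C_p C_T' L ρ t k m ε : ℝ}
    (hP₀ : 0 < P₀) (hW : 0 < W)
    (hC_rim : 0 ≤ C_rim) (hC_T : 0 ≤ C_T) (hC_T' : 0 ≤ C_T')
    (hSC : SC = C_rim + C_T + C_T' + 1) (hkey : 192 * SC ≤ P₀ * W)
    (hρ : L = 8 * ρ) (hρ1 : 1 ≤ ρ) (ht : t ^ 2 = L) (ht1 : 1 ≤ t) (htk : t ≤ k) (hkt : k ≤ t + 1)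
    (hL1 : 256 * (C_rim + 1) ≤ P₀ * t) (hL2 : 128 * (C_T + 1) ≤ P₀ * L)
    (hm0 : 0 ≤ m) (hm : m * W ≤ 3 * L)
    (hε0 : 0 ≤ ε) (hε : ε * L * (48 * (C_p + 1)) ≤ 2 * (P₀ * W)) :
    C_rim * ρ * (m + 2 * k) + C_T * ρ ^ 2 * (m + 2 * k) * k⁻¹ ^ 3 +
      (C_p * ε * ρ ^ 2 * m + C_T' * ρ ^ 2 * m * k⁻¹ ^ 3) < P₀ * ρ ^ 2 := by
  subst hρ
  have hρ0 : 0 < ρ := by linarith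
  have hk1 : 1 ≤ k := ht1.trans htk
  have hk0 : 0 < k := by linarith
  have hSC1 : C_rim ≤ SC := by rw [hSC]; linarith
  have hSC2 : C_T ≤ SC := by rw [hSC]; linarith
  have hSC3 : C_T' ≤ SC := by rw [hSC]; linarith
  -- inverse powers: `u = k⁻¹`, `k u = 1`, `u ≤ 1`, `ρ² u² ≤ ρ/8`
  have hu0 : 0 ≤ k⁻¹ := inv_nonneg.2 hk0.le
  have hku : k * k⁻¹ = 1 := mul_inv_cancel₀ hk0.ne'
  have hu1 : k⁻¹ ≤ 1 := inv_le_one_of_one_le₀ hk1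
  have hρ2u : ρ ^ 2 * k⁻¹ ^ 2 ≤ ρ / 8 := by
    have hk2 : 8 * ρ ≤ k ^ 2 := by rw [← ht]; exact pow_le_pow_left₀ (by linarith) htk 2
    have h1 : 8 * ρ * k⁻¹ ^ 2 ≤ 1 := by
      calc 8 * ρ * k⁻¹ ^ 2 ≤ k ^ 2 * k⁻¹ ^ 2 := mul_le_mul_of_nonneg_right hk2 (by positivity)
        _ = 1 := by rw [← mul_pow, hku, one_pow]
    have := mul_le_mul_of_nonneg_left h1 hρ0.le
    linarith only [this]
  -- the block bound `8 C m ≤ P₀ ρ` for `C ≤ SC`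
  have hm8 : ∀ C, 0 ≤ C → C ≤ SC → 8 * C * m ≤ P₀ * ρ := by
    intro C hC hCS
    refine le_of_mul_le_mul_right ?_ hW
    linarith only [mul_le_mul_of_nonneg_left hm (by positivity : (0 : ℝ) ≤ 8 * C),
      mul_le_mul_of_nonneg_left hCS (by positivity : (0 : ℝ) ≤ 192 * ρ),
      mul_le_mul_of_nonneg_left hkey hρ0.le]
  -- T1: the rim over the block
  have hT1 : C_rim * ρ * m ≤ P₀ * ρ ^ 2 / 8 := by
    have := mul_le_mul_of_nonneg_left (hm8 C_rim hC_rim hSC1) hρ0.le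
    linarith only [this]
  -- T2: the rim over the two collars of depth `k`
  have hT2 : C_rim * ρ * (2 * k) ≤ P₀ * ρ ^ 2 / 8 := by
    have p1 : C_rim * ρ * (2 * k) ≤ C_rim * ρ * (4 * t) :=
      mul_le_mul_of_nonneg_left (by linarith) (mul_nonneg hC_rim hρ0.le)
    have p2 : ρ * t * (256 * C_rim) ≤ ρ * t * (P₀ * t) :=
      mul_le_mul_of_nonneg_left (by linarith) (by positivity)
    have p3 : ρ * t * (P₀ * t) = 8 * P₀ * ρ ^ 2 := by
      have : t * t = 8 * ρ := by rw [← ht]; ring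
      linear_combination (P₀ * ρ) * this
    linarith only [p1, p2, p3]
  -- T3: the lattice tails, `(m + 2k) u³ = (m u + 2) u² ≤ (m + 2) u²`
  have hT3 : C_T * ρ ^ 2 * (m + 2 * k) * k⁻¹ ^ 3 ≤ P₀ * ρ ^ 2 / 32 := by
    have e1 : (m + 2 * k) * k⁻¹ ^ 3 = (m * k⁻¹ + 2) * k⁻¹ ^ 2 := by
      linear_combination (2 * k⁻¹ ^ 2) * hku
    have p1 : m * k⁻¹ + 2 ≤ m + 2 := by
      have := mul_le_mul_of_nonneg_left hu1 hm0
      linarith only [this, mul_one m]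
    have p2 : C_T * ρ ^ 2 * ((m * k⁻¹ + 2) * k⁻¹ ^ 2) ≤ C_T * ρ ^ 2 * ((m + 2) * k⁻¹ ^ 2) :=
      mul_le_mul_of_nonneg_left (mul_le_mul_of_nonneg_right p1 (by positivity)) (by positivity)
    have p3 : C_T * (m + 2) * (ρ ^ 2 * k⁻¹ ^ 2) ≤ C_T * (m + 2) * (ρ / 8) :=
      mul_le_mul_of_nonneg_left hρ2u (by positivity)
    have p4 := mul_le_mul_of_nonneg_left (hm8 C_T hC_T hSC2) hρ0.le
    have p5 := mul_le_mul_of_nonneg_left hL2 hρ0.le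
    rw [mul_assoc (C_T * ρ ^ 2) (m + 2 * k), e1]
    linarith only [p2, p3, p4, p5, hρ0.le]
  -- T4: the matching error
  have hT4 : C_p * ε * ρ ^ 2 * m ≤ P₀ * ρ ^ 2 / 8 := by
    have p1 := mul_le_mul hε hm (by positivity) (by positivity)
    have p2 : ε * m * (48 * (C_p + 1)) ≤ 6 * P₀ := by
      refine le_of_mul_le_mul_right ?_ (by positivity : (0 : ℝ) < 8 * ρ * W)
      linarith only [p1]
    have p4 : C_p * ε * m ≤ P₀ / 8 := by linarith only [p2, mul_nonneg hε0 hm0]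
    have := mul_le_mul_of_nonneg_left p4 (sq_nonneg ρ)
    linarith only [this]
  -- T5: the transfer tails
  have hT5 : C_T' * ρ ^ 2 * m * k⁻¹ ^ 3 ≤ P₀ * ρ ^ 2 / 64 := by
    have p1 : k⁻¹ ^ 3 ≤ k⁻¹ ^ 2 := pow_le_pow_of_le_one hu0 hu1 (by norm_num)
    have p2 : C_T' * m * ρ ^ 2 * k⁻¹ ^ 3 ≤ C_T' * m * ρ ^ 2 * k⁻¹ ^ 2 :=
      mul_le_mul_of_nonneg_left p1 (by positivity)
    have p3 : C_T' * m * (ρ ^ 2 * k⁻¹ ^ 2) ≤ C_T' * m * (ρ / 8) :=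
      mul_le_mul_of_nonneg_left hρ2u (by positivity)
    have p4 := mul_le_mul_of_nonneg_left (hm8 C_T' hC_T' hSC3) hρ0.le
    linarith only [p2, p3, p4]
  have hρ2 : 0 < P₀ * ρ ^ 2 := by positivity
  linarith only [hT1, hT2, hT3, hT4, hT5, hρ2]

/-! ## The assembly -/

/-- **Stub `stub_diluteAssembly`** (survey M3f): injectivity of the block-shift competitor, the
exact-lattice ledger, the perturbative transfer, the Hägg-chain block-flip facts and the uniform
gain on the box give `DiluteFaults`.  Parameters: `d₀` = LJ minimal distance
(`LennardJonesMinimalDistance_holds`), `κ` from the gain, `P₀ = κ c_col`, `h_min = 39/50 · 47/50`,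
`M₀ = ⌈192 (C_rim + C_T + C_T' + 1)/(h_min P₀)⌉₊ + 26`,
`L₀ = max 100 (max (256 (C_rim+1)/P₀)² (128 (C_T+1)/P₀))`, and for `L ≥ L₀`:
`ε₁ = min (d₀/8) (min (1/32) (P₀ h_min (M₀-2) / (48 (C_p+1) L)))`, `ρ = L/8`, `K = ⌈√L⌉₊`; the
match is re-based at the point of layer `q₁` nearest to the old base (`twoWayMatch_rebase`). -/
theorem stub_diluteAssembly :
    (∀ (a h : ℝ) (s : ℤ → ℤ) (k i₀ j₀ q₁ q₂ : ℤ) (ρ ε₁ L : ℝ) {N : ℕ} (x : Fin N → E3) (i : Fin N)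
      (A : E3 →ₗᵢ[ℝ] E3), InBox a h → IsHaggSeq s → 0 < ε₁ → ε₁ < 1 / 8 → 0 ≤ ρ →
      dist (barlowPos a h s q₁ i₀ j₀) (barlowPos a h s k i₀ j₀) + ((q₂ : ℝ) - q₁) * h + ρ + 2 ≤ L →
      Function.Injective x →
      TwoWay (barlowStacking a h s) L ε₁ x i (barlowPos a h s k i₀ j₀) A →
      Function.Injective (x + blockShift a h s k i₀ j₀ q₁ q₂ ρ ε₁ x i A)) →
    (∃ (c_col C_rim C_T : ℝ), 0 < c_col ∧ 0 ≤ C_rim ∧ 0 ≤ C_T ∧ ∀ K : ℕ, 2 ≤ K →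
      ∀ (a h : ℝ) (s : ℤ → ℤ) (q₁ q₂ i₀ j₀ : ℤ) (ρ R : ℝ) {N' : ℕ} (P : Fin N' → E3),
        InBox a h → IsHaggSeq s → q₁ < q₂ → (3 : ℤ) ∣ haggLabel s q₂ - haggLabel s q₁ → 1 ≤ ρ →
        ρ + ((q₂ : ℝ) - q₁) * h + K * h + 1 ≤ R →
        Function.Injective P →
        Set.range P = {p ∈ barlowStacking a h s | dist p (barlowPos a h s q₁ i₀ j₀) ≤ R} →
        ∃ ncol : ℕ, c_col * ρ ^ 2 ≤ ncol ∧
          changedPairSum lennardJones P (latticeShift a h s q₁ q₂ i₀ j₀ ρ P) ≤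
            ncol * ∑ m ∈ Finset.Icc (q₁ - K) q₂,
                (haggLocalEnergyTrunc K (barlowCoupling lennardJones a h)
                    (fun n : ℤ => if q₁ ≤ n ∧ n < q₂ then -s n else s n) m -
                  haggLocalEnergyTrunc K (barlowCoupling lennardJones a h) s m) +
              C_rim * ρ * ((q₂ : ℝ) - q₁ + 2 * K) +
              C_T * ρ ^ 2 * ((q₂ : ℝ) - q₁ + 2 * K) * (K : ℝ)⁻¹ ^ 3) →
    (∀ d₀ : ℝ, 0 < d₀ → ∃ (C_p C_T : ℝ), 0 ≤ C_p ∧ 0 ≤ C_T ∧ ∀ K : ℕ, 2 ≤ K →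
      ∀ (a h : ℝ) (s : ℤ → ℤ) (k i₀ j₀ q₁ q₂ : ℤ) (ρ ε₁ L R : ℝ) {N : ℕ} (x : Fin N → E3)
        (i : Fin N) (A : E3 →ₗᵢ[ℝ] E3) {N' : ℕ} (P : Fin N' → E3),
        InBox a h → IsHaggSeq s → q₁ < q₂ → 0 < ε₁ → ε₁ ≤ d₀ / 4 → ε₁ < 1 / 8 → 1 ≤ ρ →
        ρ + ((q₂ : ℝ) - q₁) * h + K * h + 1 ≤ R →
        dist (barlowPos a h s q₁ i₀ j₀) (barlowPos a h s k i₀ j₀) + R + 1 ≤ L →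
        (∀ j j' : Fin N, j ≠ j' → d₀ ≤ dist (x j) (x j')) →
        TwoWay (barlowStacking a h s) L ε₁ x i (barlowPos a h s k i₀ j₀) A →
        Function.Injective P →
        Set.range P = {p ∈ barlowStacking a h s | dist p (barlowPos a h s q₁ i₀ j₀) ≤ R} →
        |changedPairSum lennardJones x (blockShift a h s k i₀ j₀ q₁ q₂ ρ ε₁ x i A) -
            changedPairSum lennardJones P (latticeShift a h s q₁ q₂ i₀ j₀ ρ P)| ≤
          C_p * ε₁ * ρ ^ 2 * ((q₂ : ℝ) - q₁) + C_T * ρ ^ 2 * ((q₂ : ℝ) - q₁) * (K : ℝ)⁻¹ ^ 3) →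
    (∀ (s : ℤ → ℤ) (q : Fin 4 → ℤ), StrictMono q →
      ∃ i j : Fin 4, q i < q j ∧ (3 : ℤ) ∣ haggLabel s (q j) - haggLabel s (q i)) ∧
    (∀ (s : ℤ → ℤ) (q₁ q₂ : ℤ), IsHaggSeq s → q₁ < q₂ → s q₁ = s (q₁ - 1) → s q₂ = s (q₂ - 1) →
      ∀ m : ℤ,
        ((fun n : ℤ => if q₁ ≤ n ∧ n < q₂ then -s n else s n) (m + 1) =
            (fun n : ℤ => if q₁ ≤ n ∧ n < q₂ then -s n else s n) m) ↔
          (s (m + 1) = s m ∧ m ≠ q₁ - 1 ∧ m ≠ q₂ - 1)) ∧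
    (∀ (K : ℕ) (J : ℕ → ℝ) (s : ℤ → ℤ) (q₁ q₂ m : ℤ), (m + K < q₁ ∨ q₂ ≤ m) →
      haggLocalEnergyTrunc K J (fun n : ℤ => if q₁ ≤ n ∧ n < q₂ then -s n else s n) m =
        haggLocalEnergyTrunc K J s m) ∧
    (∀ (K : ℕ) (J : ℕ → ℝ) (s : ℤ → ℤ) (q₁ q₂ : ℤ), IsHaggSeq s → q₁ < q₂ →
      (3 : ℤ) ∣ haggLabel s q₂ - haggLabel s q₁ → s q₁ = s (q₁ - 1) → s q₂ = s (q₂ - 1) → 2 ≤ K →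
      ∑ m ∈ Finset.Icc (q₁ - K) q₂,
          (haggLocalEnergyTrunc K J (fun n : ℤ => if q₁ ≤ n ∧ n < q₂ then -s n else s n) m -
            haggLocalEnergyTrunc K J s m) ≤
        2 * J 2 + 2 * ∑ k ∈ Finset.Icc 3 K, ((k : ℝ) - 1) * |J k|) →
    (∃ κ : ℝ, 0 < κ ∧ ∀ a h : ℝ, InBox a h → ∀ K : ℕ, 2 ≤ K →
      2 * barlowCoupling lennardJones a h 2 +
          2 * ∑ k ∈ Finset.Icc 3 K, ((k : ℝ) - 1) * |barlowCoupling lennardJones a h k| ≤ -κ) →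
    ∃ (M₀ : ℕ) (L₀ : ℝ), ∀ L : ℝ, L₀ ≤ L → ∃ ε₁ : ℝ, 0 < ε₁ ∧
      ∀ (N : ℕ) (x : Fin N → E3), IsGroundState lennardJones x →
        ∀ (i : Fin N) (a h : ℝ) (s : ℤ → ℤ) (k i₀ j₀ : ℤ) (A : E3 →ₗᵢ[ℝ] E3), InBox a h →
          IsHaggSeq s → TwoWay (barlowStacking a h s) L ε₁ x i (barlowPos a h s k i₀ j₀) A →
          (cubicNear s k ⌊L / (2 * h)⌋₊).card ≤ M₀ := by
  intro hInj hLedger hTransfer hChain hGain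
  classical
  -- the constants of the antecedents
  obtain ⟨d₀, hd₀, hsep⟩ := LennardJonesMinimalDistance_holds
  obtain ⟨κ, hκ, hgain⟩ := hGain
  obtain ⟨c_col, C_rim, C_T, hc_col, hC_rim, hC_T, hledger⟩ := hLedger
  obtain ⟨C_p, C_T', hC_p, hC_T', htransfer⟩ := hTransfer d₀ hd₀
  obtain ⟨hChainA, -, -, hChainD⟩ := hChain
  -- the bulk gain per unit disc area `P₀`, the box lower bound `hmin` of `h`, `M₀ = ⌈Q⌉₊ + 26`
  obtain ⟨P₀, hP₀⟩ : ∃ P₀ : ℝ, P₀ = κ * c_col := ⟨_, rfl⟩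
  have hP₀pos : 0 < P₀ := by rw [hP₀]; exact mul_pos hκ hc_col
  obtain ⟨hmin, hhmin⟩ : ∃ hmin : ℝ, hmin = 39 / 50 * (47 / 50) := ⟨_, rfl⟩
  have hhmin_pos : 0 < hmin := by rw [hhmin]; norm_num
  obtain ⟨SC, hSC⟩ : ∃ SC : ℝ, SC = C_rim + C_T + C_T' + 1 := ⟨_, rfl⟩
  have hSC0 : 0 ≤ SC := by rw [hSC]; linarith
  obtain ⟨Q, hQ⟩ : ∃ Q : ℝ, Q = 192 * SC / (hmin * P₀) := ⟨_, rfl⟩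
  have hQ0 : 0 ≤ Q := by rw [hQ]; positivity
  obtain ⟨D₀, hD₀⟩ : ∃ D₀ : ℝ, D₀ = (⌈Q⌉₊ : ℝ) + 24 := ⟨_, rfl⟩
  have hD₀24 : 24 ≤ D₀ := by rw [hD₀]; linarith only [(Nat.cast_nonneg _ : (0 : ℝ) ≤ ⌈Q⌉₊)]
  have hD₀pos : 0 < D₀ := by linarith
  have hkey : 192 * SC ≤ P₀ * (hmin * D₀) := by
    have h1 : 192 * SC / (hmin * P₀) ≤ D₀ := by rw [← hQ, hD₀]; linarith only [Nat.le_ceil Q]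
    rw [div_le_iff₀ (mul_pos hhmin_pos hP₀pos)] at h1
    linarith only [h1]
  have hD₀eq : (((⌈Q⌉₊ + 26 : ℕ)) : ℝ) - 2 = D₀ := by rw [hD₀]; push_cast; ring
  refine ⟨⌈Q⌉₊ + 26, max 100 (max ((256 * (C_rim + 1) / P₀) ^ 2) (128 * (C_T + 1) / P₀)),
    fun L hL => ?_⟩
  have hL100 : 100 ≤ L := le_trans (le_max_left _ _) hL
  have hL1 : (256 * (C_rim + 1) / P₀) ^ 2 ≤ L :=
    le_trans ((le_max_left _ _).trans (le_max_right _ _)) hL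
  have hL2 : 128 * (C_T + 1) / P₀ ≤ L :=
    le_trans ((le_max_right _ _).trans (le_max_right _ _)) hL
  have hLpos : 0 < L := by linarith
  -- `ε₁ = min (d₀/8) (min (1/32) (cE/L))`
  obtain ⟨cE, hcE⟩ : ∃ cE : ℝ, cE = P₀ * (hmin * D₀) / (48 * (C_p + 1)) := ⟨_, rfl⟩
  have hcEpos : 0 < cE := by rw [hcE]; positivity
  have hcE' : cE * (48 * (C_p + 1)) = P₀ * (hmin * D₀) := by rw [hcE]; field_simp
  refine ⟨min (d₀ / 8) (min (1 / 32) (cE / L)), lt_min (by positivity) (lt_min (by norm_num)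
    (by positivity)), ?_⟩
  set ε₁ : ℝ := min (d₀ / 8) (min (1 / 32) (cE / L)) with hε₁
  have hε₁pos : 0 < ε₁ := lt_min (by positivity) (lt_min (by norm_num) (by positivity))
  have hε₁d : ε₁ ≤ d₀ / 8 := min_le_left _ _
  have hε₁s : ε₁ ≤ 1 / 32 := (min_le_right _ _).trans (min_le_left _ _)
  have hε₁L : ε₁ * L ≤ cE := (le_div_iff₀ hLpos).1 ((min_le_right _ _).trans (min_le_right _ _))
  intro N x hx i a h s k i₀ j₀ A hbox hs hW
  by_contra hcard
  push Not at hcard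
  -- box facts
  have ⟨ha47, ha1, hh39, hh17⟩ := hbox
  have ha0 : 0 < a := by linarith only [ha47]
  have hh0 : 0 < h := by linarith only [ha47, hh39]
  have hh1 : h ≤ 1 := by linarith only [ha1, hh17]
  have hhmin_le : hmin ≤ h := by linarith only [hhmin, ha47, hh39]
  -- (P): four close cubic letters `q`, and chain fact (a): a zero-charge block with cubic ends
  have hMle : ((⌊L / (2 * h)⌋₊ : ℕ) : ℝ) ≤ L / (2 * h) := Nat.floor_le (by positivity)
  have hMh : ((⌊L / (2 * h)⌋₊ : ℕ) : ℝ) * h ≤ L / 2 := by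
    rw [le_div_iff₀ (by positivity)] at hMle; linarith only [hMle]
  obtain ⟨q, hqmono, hqmem, hqspan⟩ := exists_four_close_of_card_lt (cubicNear s k ⌊L / (2 * h)⌋₊)
    k ⌊L / (2 * h)⌋₊ (⌈Q⌉₊ + 26) (by omega) (fun m hm => ((mem_cubicNear_iff s k _ m).1 hm).1) hcard
  rw [hD₀eq] at hqspan
  obtain ⟨ti, tj, hlt, hdvd⟩ := hChainA s (fun t => q t + 1) (hqmono.add_const 1)
  set q₁ : ℤ := q ti + 1 with hq₁
  set q₂ : ℤ := q tj + 1 with hq₂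
  have hc₁ : s q₁ = s (q₁ - 1) := by
    rw [hq₁, add_sub_cancel_right]; exact ((mem_cubicNear_iff s k _ _).1 (hqmem ti)).2
  have hc₂ : s q₂ = s (q₂ - 1) := by
    rw [hq₂, add_sub_cancel_right]; exact ((mem_cubicNear_iff s k _ _).1 (hqmem tj)).2
  have hm'1 : (1 : ℝ) ≤ (q₂ : ℝ) - q₁ := by
    have : ((q₁ : ℤ) : ℝ) + 1 ≤ q₂ := by exact_mod_cast (show q₁ + 1 ≤ q₂ by omega)
    linarith only [this]
  have hm'0 : (0 : ℝ) ≤ (q₂ : ℝ) - q₁ := by linarith only [hm'1]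
  have hm'D : ((q₂ : ℝ) - q₁) * D₀ ≤ 6 * ((⌊L / (2 * h)⌋₊ : ℕ) : ℝ) := by
    have e1 : ((q 0 : ℤ) : ℝ) ≤ q ti := by exact_mod_cast hqmono.monotone (Fin.zero_le _)
    have e2 : ((q tj : ℤ) : ℝ) ≤ q 3 := by exact_mod_cast hqmono.monotone (Fin.le_last tj)
    have h1 : (q₂ : ℝ) - q₁ ≤ 6 * ((⌊L / (2 * h)⌋₊ : ℕ) : ℝ) / D₀ := by
      rw [hq₁, hq₂]; push_cast; linarith only [e1, e2, hqspan]
    exact (le_div_iff₀ hD₀pos).1 h1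
  have hm'hD : ((q₂ : ℝ) - q₁) * (h * D₀) ≤ 3 * L := by
    linarith only [mul_le_mul_of_nonneg_right hm'D hh0.le, hMh]
  have hm'hmin : ((q₂ : ℝ) - q₁) * (hmin * D₀) ≤ 3 * L := by
    linarith only [hm'hD, mul_le_mul_of_nonneg_left
      (mul_le_mul_of_nonneg_right hhmin_le hD₀pos.le) hm'0]
  have hm'h8 : ((q₂ : ℝ) - q₁) * h ≤ L / 8 := by
    linarith only [hm'hD, mul_le_mul_of_nonneg_left hD₀24 (mul_nonneg hm'0 hh0.le)]
  -- the layer distance of the block from the window base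
  have hqk : |((q₁ : ℝ) - k) * h| ≤ L / 2 + 1 := by
    obtain ⟨hlo, hhi⟩ := ((mem_cubicNear_iff s k _ _).1 (hqmem ti)).1
    have hlo' : (k : ℝ) - ((⌊L / (2 * h)⌋₊ : ℕ) : ℝ) ≤ q ti := by exact_mod_cast hlo
    have hhi' : ((q ti : ℤ) : ℝ) ≤ k + ((⌊L / (2 * h)⌋₊ : ℕ) : ℝ) := by exact_mod_cast hhi
    rw [abs_mul, abs_of_pos hh0, hq₁]
    push_cast
    have habs : |(q ti : ℝ) + 1 - k| ≤ ((⌊L / (2 * h)⌋₊ : ℕ) : ℝ) + 1 :=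
      abs_le.2 ⟨by linarith only [hlo'], by linarith only [hhi']⟩
    linarith only [mul_le_mul_of_nonneg_right habs hh0.le, hMh, hh1]
  -- the new base point of layer `q₁` and the particle `i'` shadowing it
  obtain ⟨i₁, j₁, hnear⟩ := exists_barlowPos_dist_le_of_layer a h s ha0.le ha1 q₁ k i₀ j₀
  have hz'z : dist (barlowPos a h s q₁ i₁ j₁) (barlowPos a h s k i₀ j₀) ≤ L / 2 + 3 := by
    linarith only [hnear, hqk]
  obtain ⟨i', hi'⟩ := hW.1 (barlowPos a h s q₁ i₁ j₁) (barlowPos_mem q₁ i₁ j₁)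
    (by linarith only [hz'z, hL100])
  have hDi : dist (x i') (x i) ≤ L / 2 + 3 + ε₁ := by
    calc dist (x i') (x i)
        ≤ dist (x i') (x i + A (barlowPos a h s q₁ i₁ j₁ - barlowPos a h s k i₀ j₀)) +
            dist (x i + A (barlowPos a h s q₁ i₁ j₁ - barlowPos a h s k i₀ j₀)) (x i) :=
          dist_triangle _ _ _
      _ ≤ ε₁ + (L / 2 + 3) := by
          refine add_le_add hi' ?_
          rwa [dist_self_add_left, LinearIsometry.norm_map, ← dist_eq_norm]
      _ = L / 2 + 3 + ε₁ := by ring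
  -- the parameters `ρ = L/8`, `t = √L`, `K = ⌈t⌉₊`, `R`, `R' = R + 1`
  obtain ⟨ρ, hρ⟩ : ∃ ρ : ℝ, ρ = L / 8 := ⟨_, rfl⟩
  have hρ1 : 1 ≤ ρ := by linarith only [hρ, hL100]
  have hLρ : L = 8 * ρ := by rw [hρ]; ring
  obtain ⟨t, ht⟩ : ∃ t : ℝ, t = Real.sqrt L := ⟨_, rfl⟩
  have ht0 : 0 ≤ t := by rw [ht]; exact Real.sqrt_nonneg L
  have htt : t ^ 2 = L := by rw [ht]; exact Real.sq_sqrt hLpos.le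
  have ht10 : 10 ≤ t := by rw [ht]; exact Real.le_sqrt_of_sq_le (by linarith only [hL100])
  have hL1' : 256 * (C_rim + 1) ≤ P₀ * t := by
    have htC : 256 * (C_rim + 1) / P₀ ≤ t := by rw [ht]; exact Real.le_sqrt_of_sq_le hL1
    rw [div_le_iff₀ hP₀pos] at htC; linarith only [htC]
  have hL2' : 128 * (C_T + 1) ≤ P₀ * L := by
    rw [div_le_iff₀ hP₀pos] at hL2; linarith only [hL2]
  have h10t : 10 * t ≤ L := by nlinarith only [mul_le_mul_of_nonneg_left ht10 ht0, htt]
  obtain ⟨K, hK⟩ : ∃ K : ℕ, K = ⌈t⌉₊ := ⟨_, rfl⟩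
  have hKt : t ≤ (K : ℝ) := by rw [hK]; exact Nat.le_ceil t
  have hKt1 : (K : ℝ) ≤ t + 1 := by rw [hK]; exact (Nat.ceil_lt_add_one ht0).le
  have hK2 : 2 ≤ K := by
    have : 1 < K := by rw [hK]; exact Nat.lt_ceil.2 (by push_cast; linarith only [ht10])
    omega
  have hKh : (K : ℝ) * h ≤ t + 1 := by
    linarith only [mul_le_mul_of_nonneg_left hh1 (Nat.cast_nonneg K), hKt1]
  have hKh0 : (0 : ℝ) ≤ K * h := by positivity
  obtain ⟨R, hR⟩ : ∃ R : ℝ, R = ρ + ((q₂ : ℝ) - q₁) * h + K * h + 1 := ⟨_, rfl⟩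
  obtain ⟨R', hR'⟩ : ∃ R' : ℝ, R' = R + 1 := ⟨_, rfl⟩
  -- the re-based window: radius `R'`, tolerance `2 ε₁`, base `barlowPos a h s q₁ i₁ j₁`
  have hW' : TwoWay (barlowStacking a h s) R' (2 * ε₁) x i' (barlowPos a h s q₁ i₁ j₁) A :=
    twoWayMatch_rebase x i i' (barlowStacking a h s) (barlowPos a h s k i₀ j₀)
      (barlowPos a h s q₁ i₁ j₁) A
      (by linarith only [hR', hR, hρ, hm'h8, hKh, h10t, ht10, hε₁s]) hW hDi hi'
  have h2ε0 : 0 < 2 * ε₁ := by linarith only [hε₁pos]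
  have h2ε8 : 2 * ε₁ < 1 / 8 := by linarith only [hε₁s]
  have h2εd : 2 * ε₁ ≤ d₀ / 4 := by linarith only [hε₁d]
  -- (W): the exact lattice shadow
  obtain ⟨N', P, hPinj, hPrange⟩ :=
    exists_fin_enum_barlowStacking_dist_le a h s (barlowPos a h s q₁ i₁ j₁) R ha0 hh0
  -- (M3a) + (G): the competitor is injective, so the ground state gives `0 ≤ Δ(x)`
  have hG := changedPairSum_nonneg_of_isGroundState hx (hInj a h s q₁ i₁ j₁ q₁ q₂ ρ (2 * ε₁) R'
    x i' A hbox hs h2ε0 h2ε8 (by linarith only [hρ1])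
    (by rw [dist_self, hR', hR]; linarith only [hKh0]) hx.1 hW')
  -- (M3c+e) the ledger, (M3d) the transfer, chain fact (d) and the uniform gain
  have hRfit : ρ + ((q₂ : ℝ) - q₁) * h + K * h + 1 ≤ R := by rw [hR]
  obtain ⟨ncol, hncol, hΔP⟩ := hledger K hK2 a h s q₁ q₂ i₁ j₁ ρ R P hbox hs hlt hdvd hρ1 hRfit
    hPinj hPrange
  have hΔ := (abs_le.1 (htransfer K hK2 a h s q₁ i₁ j₁ q₁ q₂ ρ (2 * ε₁) R' R x i' A P hbox hs
    hlt h2ε0 h2εd h2ε8 hρ1 hRfit (by rw [dist_self, hR', zero_add]) (hsep N x hx) hW' hPinj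
    hPrange)).2
  have hSig := (hChainD K (barlowCoupling lennardJones a h) s q₁ q₂ hs hlt hdvd hc₁ hc₂ hK2).trans
    (hgain a h hbox K hK2)
  have h1 := mul_le_mul_of_nonneg_left hSig (Nat.cast_nonneg ncol)
  have h2 : (ncol : ℝ) * -κ ≤ -(P₀ * ρ ^ 2) := by
    calc (ncol : ℝ) * -κ ≤ c_col * ρ ^ 2 * -κ :=
          mul_le_mul_of_nonpos_right hncol (by linarith only [hκ])
      _ = -(P₀ * ρ ^ 2) := by rw [hP₀]; ring
  -- the error terms are smaller than the bulk gain
  have hεcore : 2 * ε₁ * L * (48 * (C_p + 1)) ≤ 2 * (P₀ * (hmin * D₀)) := by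
    linarith only [mul_le_mul_of_nonneg_right hε₁L (by positivity : (0 : ℝ) ≤ 48 * (C_p + 1)),
      hcE']
  have hcore := assembly_core hP₀pos (mul_pos hhmin_pos hD₀pos) hC_rim hC_T hC_T' hSC hkey
    hLρ hρ1 htt (by linarith only [ht10]) hKt hKt1 hL1' hL2' hm'0 hm'hmin h2ε0.le hεcore
  linarith only [hG, hΔ, hΔP, h1, h2, hcore]

end Summit.AtomisticToContinuum.Crystallization.Theorems.SquareWellLayerCake.StackingFaultSparsity

end
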